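import Summits.CriticalPhenomena.CardyFormulaZ2.Theorems.CardySelfRefinementLagHandOffNoIdleAuxDoublePoints
import HarnessLib

/-!
# No idling of the limit interface, part 7b: a curve idling inside its past range has many
alternation points on every fine grid — arbitrary (non-light) representatives

Helper file for the registered stub `stub_limitCurveRegularity_noIdle` of line
`hitting-tournament` of crux `LagHandOff` (stmt-CriticalPhenomena-10268).  Part 7
(`exists_forall_le_card_filter_altEvent`, file `…NoIdleAuxDoublePoints`) proves the deterministic
heart of the first-moment argument for LIGHT curves (no interval of constancy).  The stub
quantifies over ALL representatives of the limit class, and a curve class need not be presented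
by a light representative; this file removes the lightness hypothesis, replacing it by the bare
negation of the no-idling dichotomy on `(s, t)`: `c₀` is NOT constant on `[s, t]` and stays inside
its past range `c₀[0, s]` during `(s, t)` (`exists_forall_le_card_filter_altEvent_of_not_const`).

Proof.  Lightness was used twice in part 7: (a) to see that some time of `(s, t)` is mapped into
the open domain `D` — here non-constancy on `[s, t]` suffices verbatim (otherwise `c₀[s, t] ⊆ ∂D`
is a point by the no-trace hypothesis); (b) to find `s < p < q < t` with `c₀ p ≠ c₀ q` and
`c₀[p, q]` in the bulk.  For (b) we argue by connectedness instead: if `c₀ p = c₀ q` whenever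
`s < p < q < t` and `c₀[p, q] ⊆ D`, then the set `W` of times `u ∈ (s, t)` with `c₀ u ∈ D` and
`c₀ u = c₀ u₀` (`u₀` the interior time of (a)) is open (balls around a time mapped into the open
`D` are mapped into `D`, and `c₀` is then constant on them) and relatively closed in `(s, t)` (its
closure is mapped to the point `c₀ u₀ ∈ D`), hence all of `(s, t)` (`isPreconnected_Ioo`), and
`c₀` is constant on `[s, t]` — a contradiction.  The bulk margin `μ` is a closed-thickening radius
of the compact `c₀[p, q]` inside the open `D` (`IsCompact.exists_cthickening_subset_open`).  The
rest (projection on the chord, the `⌊R/ε⌋ + 1` levels, rounding to the grid, the alternation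
pattern near/far/near with far ends) is part 7 verbatim.

References: M. Aizenman, A. Burchard, Duke Math. J. 99 (1999), §1.b, §2 (traversal counts of
shells as curve functionals); A. Kemppainen, S. Smirnov, Ann. Probab. 45 (2017), Thm. 1.5
(no idling of the limit of the bond-`ℤ²` interface).
-/

noncomputable section

open Set Filter Topology Metric
open scoped unitInterval
open Literature.Probability.Percolation Literature.Probability.RandomPlanarGeometry

namespace Summit.CriticalPhenomena.CardyFormulaZ2.Cruxes.LagHandOff.HittingTournament

/-! ### A non-constant piece in the bulk -/

/-- **Step (a): some time of `(s, t)` is mapped into the open domain**, for a curve of `D̄` which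
traces no boundary arc and is not constant on `[s, t]`.  Otherwise `c₀[s, t] ⊆ ∂D` (the ends by
continuity), a point by the no-trace hypothesis. [cite: KemppainenSmirnov2017, Thm. 1.5] -/
theorem exists_mem_Ioo_mem_carrier (D : DobrushinDomain) {c₀ : Curve ℂ}
    (hcl : ∀ u, c₀ u ∈ closure D.carrier)
    (hnt : ∀ p q : I, p < q → c₀ '' Icc p q ⊆ frontier D.carrier → (c₀ '' Icc p q).Subsingleton)
    {s t : I} (hst : s < t) (hnc : ¬ ∀ u ∈ Icc s t, c₀ u = c₀ s) :
    ∃ u₀ ∈ Ioo s t, c₀ u₀ ∈ D.carrier := by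
  have hopen := D.isOpen
  by_contra H
  push Not at H
  have hfr : ∀ u ∈ Ioo s t, c₀ u ∈ frontier D.carrier := fun u hu => by
    rw [hopen.frontier_eq]; exact ⟨hcl u, H u hu⟩
  have hclosed : IsClosed ((c₀ : I → ℂ) ⁻¹' frontier D.carrier) :=
    isClosed_frontier.preimage c₀.continuous
  have hsub' : Icc s t ⊆ (c₀ : I → ℂ) ⁻¹' frontier D.carrier := by
    rw [← closure_Ioo hst.ne]
    exact hclosed.closure_subset_iff.2 fun u hu => hfr u hu
  have hsub : c₀ '' Icc s t ⊆ frontier D.carrier := by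
    rintro _ ⟨u, hu, rfl⟩
    exact hsub' hu
  obtain ⟨u, hu, hne⟩ : ∃ u ∈ Icc s t, c₀ u ≠ c₀ s := by
    by_contra h'
    push Not at h'
    exact hnc h'
  exact hne ((hnt s t hst hsub) (mem_image_of_mem _ hu)
    (mem_image_of_mem _ (left_mem_Icc.2 hst.le)))

/-- **Step (b): a non-constant piece in the bulk.** Under the hypotheses of
`exists_mem_Ioo_mem_carrier` there are `s < p < q < t` with `c₀ p ≠ c₀ q` and `c₀[p, q] ⊆ D`
(connectedness of `(s, t)`; see the module docstring). [cite: KemppainenSmirnov2017, Thm. 1.5] -/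
theorem exists_ne_forall_mem_carrier (D : DobrushinDomain) {c₀ : Curve ℂ}
    (hcl : ∀ u, c₀ u ∈ closure D.carrier)
    (hnt : ∀ p q : I, p < q → c₀ '' Icc p q ⊆ frontier D.carrier → (c₀ '' Icc p q).Subsingleton)
    {s t : I} (hst : s < t) (hnc : ¬ ∀ u ∈ Icc s t, c₀ u = c₀ s) :
    ∃ p q : I, s < p ∧ p < q ∧ q < t ∧ c₀ p ≠ c₀ q ∧
      ∀ u : I, p ≤ u → u ≤ q → c₀ u ∈ D.carrier := by
  have hopen := D.isOpen
  obtain ⟨u₀, ⟨hsu₀, hu₀t⟩, hu₀D⟩ := exists_mem_Ioo_mem_carrier D hcl hnt hst hnc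
  by_contra H
  have H' : ∀ p q : I, s < p → p < q → q < t →
      (∀ u : I, p ≤ u → u ≤ q → c₀ u ∈ D.carrier) → c₀ p = c₀ q := by
    intro p q h1 h2 h3 h4
    by_contra hne
    exact H ⟨p, q, h1, h2, h3, hne, h4⟩
  set W : Set I := {u | u ∈ Ioo s t ∧ c₀ u ∈ D.carrier ∧ c₀ u = c₀ u₀} with hW
  have hclosedpt : IsClosed {x : I | c₀ x = c₀ u₀} := isClosed_eq c₀.continuous continuous_const
  -- `W` is open
  have hWopen : IsOpen W := by
    rw [Metric.isOpen_iff]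
    rintro u ⟨hu, huD, huu₀⟩
    have ho : IsOpen ((c₀ : I → ℂ) ⁻¹' D.carrier ∩ Ioo s t) :=
      (hopen.preimage c₀.continuous).inter isOpen_Ioo
    obtain ⟨η, hη, hball⟩ := Metric.isOpen_iff.1 ho u ⟨huD, hu⟩
    refine ⟨η, hη, fun u' hu' => ?_⟩
    obtain ⟨hu'D, hu'st⟩ := hball hu'
    have hu'r := hu'
    rw [mem_ball, Subtype.dist_eq, Real.dist_eq, abs_lt] at hu'r
    have hnear : ∀ x : I, (min (u' : ℝ) u ≤ x) → ((x : ℝ) ≤ max (u' : ℝ) u) → c₀ x ∈ D.carrier := by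
      intro x hx1 hx2
      refine (hball ?_).1
      rw [mem_ball, Subtype.dist_eq, Real.dist_eq, abs_lt]
      rcases le_total (u' : ℝ) u with h | h
      · rw [min_eq_left h] at hx1
        rw [max_eq_right h] at hx2
        constructor <;> linarith [hx1, hx2, hu'r.1, hu'r.2]
      · rw [min_eq_right h] at hx1
        rw [max_eq_left h] at hx2
        constructor <;> linarith [hx1, hx2, hu'r.1, hu'r.2]
    refine ⟨hu'st, hu'D, ?_⟩
    rcases lt_trichotomy u' u with hlt | heq | hgt
    · -- `u' < u`: constancy on `[u', u]`
      have hlt' : (u' : ℝ) < u := Subtype.coe_lt_coe.2 hlt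
      have := H' u' u hu'st.1 hlt hu.2 fun x hx1 hx2 => hnear x
        (by rw [min_eq_left hlt'.le]; exact Subtype.coe_le_coe.2 hx1)
        (by rw [max_eq_right hlt'.le]; exact Subtype.coe_le_coe.2 hx2)
      rw [this, huu₀]
    · rw [heq, huu₀]
    · -- `u < u'`: constancy on `[u, u']`
      have hgt' : (u : ℝ) < u' := Subtype.coe_lt_coe.2 hgt
      have := H' u u' hu.1 hgt hu'st.2 fun x hx1 hx2 => hnear x
        (by rw [min_eq_right hgt'.le]; exact Subtype.coe_le_coe.2 hx1)
        (by rw [max_eq_left hgt'.le]; exact Subtype.coe_le_coe.2 hx2)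
      rw [← this, huu₀]
  -- `W` is relatively closed in `(s, t)`
  have hWcl : closure W ∩ Ioo s t ⊆ W := by
    rintro u ⟨hucl, hu⟩
    have hcu : c₀ u = c₀ u₀ := hclosedpt.closure_subset_iff.2 (fun x hx => hx.2.2) hucl
    exact ⟨hu, by rw [hcu]; exact hu₀D, hcu⟩
  have hsub : Ioo s t ⊆ W := isPreconnected_Ioo.subset_of_closure_inter_subset hWopen
    ⟨u₀, ⟨hsu₀, hu₀t⟩, ⟨hsu₀, hu₀t⟩, hu₀D, rfl⟩ hWcl
  -- hence `c₀` is constant on `[s, t]`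
  have hconst : ∀ u ∈ Icc s t, c₀ u = c₀ u₀ := by
    have h1 : closure (Ioo s t) ⊆ {x : I | c₀ x = c₀ u₀} :=
      hclosedpt.closure_subset_iff.2 fun x hx => (hsub hx).2.2
    rw [closure_Ioo hst.ne] at h1
    exact fun u hu => h1 hu
  exact hnc fun u hu => by rw [hconst u hu, hconst s (left_mem_Icc.2 hst.le)]

/-! ### Many alternation points for a curve idling inside its past range -/

-- adapted from `exists_forall_le_card_filter_altEvent`
-- (Summits/…/CardySelfRefinementLagHandOffNoIdleAuxDoublePoints.lean): the lightness hypothesis is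
-- replaced by non-constancy on `[s, t]`, through `exists_ne_forall_mem_carrier`.
open scoped Classical in
/-- **A curve idling inside its past range has many bulk alternation points on every fine grid
(arbitrary representative).** Let `c₀` be a curve in the closure of a Dobrushin domain `D`, with
both ends on `∂D`, tracing no boundary arc, NOT constant on `[s, t]`, which during `(s, t)` stays
inside its past range `c₀[0, s]`. Then there is `R₀ > 0` such that for all `0 < R ≤ R₀`, all `ε`
with `1000ε ≤ R` and every square grid `εℤ² ∩ [-Lε, Lε]²` covering the trace, at least
`⌊R/ε⌋ + 1` grid points `g` at distance `≥ 2R` from `∂D` see the class of `c₀` in the alternation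
event `altEvent g (2ε) R`. [cite: KemppainenSmirnov2017, Thm. 1.5]
[cite: AizenmanBurchardDuke1999, §1.b] -/
theorem exists_forall_le_card_filter_altEvent_of_not_const (D : DobrushinDomain) {c₀ : Curve ℂ}
    (hcl : ∀ u, c₀ u ∈ closure D.carrier) (h0 : c₀ 0 ∈ frontier D.carrier)
    (h1 : c₀ 1 ∈ frontier D.carrier)
    (hnt : ∀ p q : I, p < q → c₀ '' Icc p q ⊆ frontier D.carrier → (c₀ '' Icc p q).Subsingleton)
    {s t : I} (hst : s < t) (hnc : ¬ ∀ u ∈ Icc s t, c₀ u = c₀ s)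
    (hpast : ∀ u ∈ Ioo s t, c₀ u ∈ c₀ '' Icc 0 s)
    {Rad : ℝ} (hRad : ∀ u, ‖c₀ u‖ ≤ Rad) :
    ∃ R₀ : ℝ, 0 < R₀ ∧ ∀ R : ℝ, 0 < R → R ≤ R₀ → ∀ ε : ℝ, 0 < ε → 1000 * ε ≤ R →
      ∀ L : ℕ, Rad / ε + 1 ≤ L →
        ⌊R / ε⌋₊ + 1 ≤ ((sqGrid ε L).filter fun g =>
          2 * R ≤ infDist g (frontier D.carrier) ∧ CurveClass.mk c₀ ∈ altEvent g (2 * ε) R).card := by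
  classical
  have hopen := D.isOpen
  ---------------------------------------------------------------- the piece `[p, q]`
  obtain ⟨p, q, hsp', hpq', hqt, hne, hpqD⟩ := exists_ne_forall_mem_carrier D hcl hnt hst hnc
  ---------------------------------------------------------------- the bulk margin
  have hK : IsCompact (c₀ '' Icc p q) := isCompact_Icc.image c₀.continuous
  have hKD : c₀ '' Icc p q ⊆ D.carrier := by
    rintro _ ⟨u, hu, rfl⟩; exact hpqD u hu.1 hu.2
  obtain ⟨μ, hμ, hμsub⟩ := hK.exists_cthickening_subset_open hopen hKD
  have hfront : ∀ u : I, p ≤ u → u ≤ q → ∀ w ∈ frontier D.carrier, μ ≤ dist (c₀ u) w := by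
    intro u hu1 hu2 w hw
    by_contra hlt
    push Not at hlt
    have hwD : w ∈ D.carrier := by
      refine hμsub (mem_cthickening_of_dist_le w (c₀ u) μ _ (mem_image_of_mem _ ⟨hu1, hu2⟩) ?_)
      rw [dist_comm]; exact hlt.le
    have : w ∈ D.carrier ∩ frontier D.carrier := ⟨hwD, hw⟩
    rw [hopen.inter_frontier_eq] at this
    exact this
  ---------------------------------------------------------------- the scales
  set d : ℝ := dist (c₀ p) (c₀ q) with hd
  have hdpos : 0 < d := dist_pos.2 hne
  refine ⟨min (μ / 6) (d / 8), by positivity, ?_⟩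
  intro R hR hRle ε hε hεR L hL
  have hRμ : R ≤ μ / 6 := hRle.trans (min_le_left _ _)
  have hRd : R ≤ d / 8 := hRle.trans (min_le_right _ _)
  ---------------------------------------------------------------- the projection on the chord
  set v : ℂ := c₀ q - c₀ p with hv
  have hvn : ‖v‖ = d := by rw [hv, hd, dist_comm, dist_eq_norm]
  set φ : I → ℝ := fun u => ((starRingEnd ℂ) v * (c₀ u - c₀ p)).re / d with hφ
  have hφc : Continuous φ := by
    refine Continuous.div_const (Complex.continuous_re.comp (continuous_const.mul ?_)) d
    exact c₀.continuous.sub continuous_const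
  have hφp : φ p = 0 := by simp [hφ]
  have hφq : φ q = d := by
    simp only [hφ]
    rw [← hv, ← Complex.normSq_eq_conj_mul_self, Complex.ofReal_re, Complex.normSq_eq_norm_sq,
      hvn, sq, mul_div_cancel_right₀ _ hdpos.ne']
  have hφlip : ∀ u u' : I, |φ u - φ u'| ≤ dist (c₀ u) (c₀ u') := by
    intro u u'
    simp only [hφ]
    rw [← sub_div, ← Complex.sub_re, ← mul_sub, abs_div, abs_of_pos hdpos,
      div_le_iff₀ hdpos, show c₀ u - c₀ p - (c₀ u' - c₀ p) = c₀ u - c₀ u' by ring]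
    have h1 := Complex.abs_re_le_norm ((starRingEnd ℂ) v * (c₀ u - c₀ u'))
    rw [norm_mul, Complex.norm_conj, hvn, ← dist_eq_norm] at h1
    linarith
  ---------------------------------------------------------------- the levels and the points
  set N : ℕ := ⌊R / ε⌋₊ with hN
  have hNε : (N : ℝ) * ε ≤ R := by
    have := Nat.floor_le (show 0 ≤ R / ε by positivity)
    rw [← hN] at this
    have := mul_le_mul_of_nonneg_right this hε.le
    rwa [div_mul_cancel₀ _ hε.ne'] at this
  have hlev : ∀ i : ℕ, i ≤ N → d / 2 + 3 * ε * i ∈ Icc (φ p) (φ q) := by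
    intro i hi
    rw [hφp, hφq]
    have hi' : (i : ℝ) ≤ N := by exact_mod_cast hi
    constructor
    · positivity
    · nlinarith
  have hex : ∀ i : ℕ, ∃ u : I, i ≤ N → (u ∈ Icc p q ∧ φ u = d / 2 + 3 * ε * i) := by
    intro i
    by_cases hi : i ≤ N
    · obtain ⟨u, hu, hφu⟩ := intermediate_value_Icc hpq'.le hφc.continuousOn (hlev i hi)
      exact ⟨u, fun _ => ⟨hu, hφu⟩⟩
    · exact ⟨p, fun h => absurd h hi⟩
  choose uf huf using hex
  set z : ℕ → ℂ := fun i => c₀ (uf i) with hz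
  set gi : ℕ → ℂ := fun i =>
    ((ε * round ((z i).re / ε) : ℝ) : ℂ) + ((ε * round ((z i).im / ε) : ℝ) : ℂ) * Complex.I with hgi
  have hgz : ∀ i, dist (gi i) (z i) ≤ ε := fun i => dist_round_grid_le hε (z i)
  -- distances from `c₀ p` and between the points
  have hfar_p : ∀ i, i ≤ N → d / 2 ≤ dist (z i) (c₀ p) := by
    intro i hi
    obtain ⟨-, hφu⟩ := huf i hi
    have h := hφlip (uf i) p
    rw [hφu, hφp, sub_zero, abs_of_nonneg (by positivity)] at h
    have : (0 : ℝ) ≤ 3 * ε * i := by positivity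
    exact le_trans (by linarith) h
  have hsep : ∀ i j, i ≤ N → j ≤ N → i ≠ j → 3 * ε ≤ dist (z i) (z j) := by
    intro i j hi hj hij
    obtain ⟨-, hφi⟩ := huf i hi
    obtain ⟨-, hφj⟩ := huf j hj
    have h := hφlip (uf i) (uf j)
    rw [hφi, hφj] at h
    have h1 : |d / 2 + 3 * ε * i - (d / 2 + 3 * ε * j)| = 3 * ε * |(i : ℝ) - j| := by
      rw [show d / 2 + 3 * ε * i - (d / 2 + 3 * ε * j) = 3 * ε * ((i : ℝ) - j) by ring, abs_mul,
        abs_of_pos (by positivity : (0 : ℝ) < 3 * ε)]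
    rw [h1] at h
    have h2 : (1 : ℝ) ≤ |(i : ℝ) - j| := by
      rcases lt_or_gt_of_ne hij with hlt | hlt
      · have : (i : ℝ) + 1 ≤ j := by exact_mod_cast hlt
        rw [abs_of_neg (by linarith)]; linarith
      · have : (j : ℝ) + 1 ≤ i := by exact_mod_cast hlt
        rw [abs_of_pos (by linarith)]; linarith
    nlinarith
  ---------------------------------------------------------------- the grid points qualify
  have hfrne : (frontier D.carrier).Nonempty := ⟨_, h0⟩
  have hqual : ∀ i, i ≤ N → gi i ∈ (sqGrid ε L).filter fun g =>
      2 * R ≤ infDist g (frontier D.carrier) ∧ CurveClass.mk c₀ ∈ altEvent g (2 * ε) R := by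
    intro i hi
    obtain ⟨⟨hpu, huq⟩, hφu⟩ := huf i hi
    refine Finset.mem_filter.2 ⟨?_, ?_, ?_⟩
    · -- in the grid
      have hzR : ‖z i‖ ≤ Rad := hRad _
      refine mem_sqGrid ?_ ?_
      · have := abs_round_div_le hε ((Complex.abs_re_le_norm (z i)).trans hzR)
        have : |((round ((z i).re / ε) : ℤ) : ℝ)| ≤ (L : ℝ) := this.trans hL
        exact_mod_cast this
      · have := abs_round_div_le hε ((Complex.abs_im_le_norm (z i)).trans hzR)
        have : |((round ((z i).im / ε) : ℤ) : ℝ)| ≤ (L : ℝ) := this.trans hL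
        exact_mod_cast this
    · -- in the bulk
      have hzi : μ ≤ infDist (z i) (frontier D.carrier) :=
        (le_infDist hfrne).2 fun w hw => hfront (uf i) hpu huq w hw
      have := infDist_le_infDist_add_dist (x := z i) (y := gi i) (s := frontier D.carrier)
      rw [dist_comm] at this
      linarith [hgz i]
    · -- the alternation
      have hut : uf i ∈ Ioo s t := ⟨hsp'.trans_le hpu, lt_of_le_of_lt huq hqt⟩
      obtain ⟨u₁, hu₁, hu₁z⟩ := hpast (uf i) hut
      have hpui : p < uf i := by
        refine lt_of_le_of_ne hpu fun h => ?_
        have := hfar_p i hi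
        rw [hz] at this
        simp only [← h, dist_self] at this
        linarith
      refine mk_mem_altEvent_iff.2 ⟨u₁, p, uf i, lt_of_le_of_lt hu₁.2 hsp', hpui, ?_, ?_, ?_, ?_, ?_⟩
      · rw [hu₁z]
        have := hgz i
        rw [dist_comm] at this
        show dist (z i) (gi i) < 2 * ε
        linarith
      · have h2 := hfar_p i hi
        show R < dist (c₀ p) (gi i)
        linarith [dist_triangle (z i) (gi i) (c₀ p), dist_comm (z i) (gi i), hgz i,
          dist_comm (gi i) (c₀ p)]
      · show dist (z i) (gi i) < 2 * ε
        linarith [hgz i, dist_comm (z i) (gi i)]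
      · have h2 : μ ≤ dist (z i) (c₀ 0) := hfront (uf i) hpu huq _ h0
        show R < dist (c₀ 0) (gi i)
        linarith [dist_triangle (z i) (gi i) (c₀ 0), hgz i, dist_comm (z i) (gi i),
          dist_comm (gi i) (c₀ 0)]
      · have h2 : μ ≤ dist (z i) (c₀ 1) := hfront (uf i) hpu huq _ h1
        show R < dist (c₀ 1) (gi i)
        linarith [dist_triangle (z i) (gi i) (c₀ 1), hgz i, dist_comm (z i) (gi i),
          dist_comm (gi i) (c₀ 1)]
  ---------------------------------------------------------------- counting
  have hinj : Set.InjOn gi (Finset.range (N + 1) : Set ℕ) := by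
    intro i hi j hj hij
    have hi' : i ≤ N := Nat.lt_succ_iff.1 (Finset.mem_range.1 hi)
    have hj' : j ≤ N := Nat.lt_succ_iff.1 (Finset.mem_range.1 hj)
    by_contra hne'
    have h3 := hsep i j hi' hj' hne'
    have : dist (z i) (z j) ≤ 2 * ε := by
      have h4 : dist (gi i) (gi j) = 0 := by rw [hij, dist_self]
      linarith [dist_triangle (z i) (gi i) (z j), dist_triangle (gi i) (gi j) (z j), hgz i, hgz j,
        dist_comm (z i) (gi i)]
    linarith
  calc N + 1 = ((Finset.range (N + 1)).image gi).card := by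
        rw [Finset.card_image_of_injOn hinj, Finset.card_range]
    _ ≤ _ := Finset.card_le_card fun g hg => by
        obtain ⟨i, hi, rfl⟩ := Finset.mem_image.1 hg
        exact hqual i (Nat.lt_succ_iff.1 (Finset.mem_range.1 hi))

open scoped Classical in
/-- **Registered sub-stub `stub_noIdle_doublePointsGen`** (line `hitting-tournament`, stub
`stub_limitCurveRegularity_noIdle`, helper 7b): `exists_forall_le_card_filter_altEvent_of_not_const`
with all arguments explicit — the double-points lemma for an ARBITRARY representative violating
the no-idling dichotomy on `(s, t)`. [cite: KemppainenSmirnov2017, Thm. 1.5] -/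
theorem stub_noIdle_doublePointsGen : ∀ (D : DobrushinDomain) (c₀ : Curve ℂ), (∀ u, c₀ u ∈ closure D.carrier) → c₀ 0 ∈ frontier D.carrier → c₀ 1 ∈ frontier D.carrier → (∀ p q : unitInterval, p < q → c₀ '' Set.Icc p q ⊆ frontier D.carrier → (c₀ '' Set.Icc p q).Subsingleton) → ∀ (s t : unitInterval), s < t → (¬ ∀ u ∈ Set.Icc s t, c₀ u = c₀ s) → (∀ u ∈ Set.Ioo s t, c₀ u ∈ c₀ '' Set.Icc 0 s) → ∀ (Rad : ℝ), (∀ u, ‖c₀ u‖ ≤ Rad) → ∃ R₀ : ℝ, 0 < R₀ ∧ ∀ R : ℝ, 0 < R → R ≤ R₀ → ∀ ε : ℝ, 0 < ε → 1000 * ε ≤ R → ∀ L : ℕ, Rad / ε + 1 ≤ L → ⌊R / ε⌋₊ + 1 ≤ ((sqGrid ε L).filter fun g => 2 * R ≤ Metric.infDist g (frontier D.carrier) ∧ CurveClass.mk c₀ ∈ altEvent g (2 * ε) R).card :=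
  fun D _ hcl h0 h1 hnt _ _ hst hnc hpast _ hRad =>
    exists_forall_le_card_filter_altEvent_of_not_const D hcl h0 h1 hnt hst hnc hpast hRad

end Summit.CriticalPhenomena.CardyFormulaZ2.Cruxes.LagHandOff.HittingTournament

end
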